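import Literature.Computability.AlgebraicComplexity.LaserMethodRestriction
import Literature.Computability.AlgebraicComplexity.PartitionedTensors
import Literature.Computability.AlgebraicComplexity.GroupAlgebraTensor
import HarnessLib

/-!
# The laser method with general components, tensor layer: the blocks of a free diagonal of one
joint type are `|Δ|` independent copies of `⊗_s t(s)^{⊗ N P(s)}` (Le Gall 2014, proof of Thm. 4.1) — proved

Topic `Literature/Computability/AlgebraicComplexity`.  In the laser method for a partitioned tensor
`t` whose components `t(i,j,l)` are ARBITRARY tensors (Coppersmith–Winograd 1990 §8, Stothers,
Vassilevska Williams, Le Gall 2014 Thm. 4.1; the matrix-component case is BCS 1997 Thm. 15.41,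
`LaserMethodRestriction.lean`/`LaserMethodTheorem.lean`), the `N`-th power `t^{⊗N}` is partitioned
into the blocks `t^{⊗N}(x,y,z) = ⊗_ρ t(x_ρ, y_ρ, z_ρ)` indexed by triples of label words, a free
diagonal `Δ` of blocks is extracted by hashing, and — this is where general components differ from
matrix components — `Δ` is taken inside ONE joint type `Q` (Le Gall's `Λ*`: "(a,b,c) has type `Q`"
iff every `s ∈ S` occurs at exactly `N Q(s)` coordinates), so that all blocks of `Δ` are ISOMORPHIC
to the single tensor `⊗_s t(s)^{⊗ N Q(s)}` and `t^{⊗N} ⊵ |Δ| ⊙ ⊗_s t(s)^{⊗NQ(s)}` (Le Gall 2014,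
Appendix A.3, Eqs. (4)–(8): "`t̂ = ⊕_{Δ} t̂(u,v,w)` … the sum is direct since the components do not
share variables … `V_ρ(t̂(u,v,w)) ≥ ∏_s V_ρ(t(s))^{N P(s)}`").  This file PROVES that tensor
statement in coordinates (setting of `LaserMethodRestriction.lean`: `t : ι → κ → μ → K`, block
labels `bI, bJ, bL`, a finite `S ⊇ supp_D t`; components as zero-outs `partSubtensor`, blocks as
Kronecker products of families `kroneckerPi`):

* `laserBlock bI bJ bL t w` — the block of `t^{⊗N}` with label word `w : Fin N → I × J × L`, i.e.
  `⊗_ρ t(w_ρ)` where `t(s) = partSubtensor bI bJ bL t {i} {j} {l}` is the component `s = (i,j,l)`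
  (a zero-out of `t`, same format as `t`); `laserBlock_apply`: it is the zero-out of `t^{⊗N}` to
  the words labelled `w`.
* `tensorRestrictsTo_kroneckerPow_familyDirectSum_laserBlock` — **a free diagonal of blocks is a
  restriction**: for `Δ` free with respect to the coordinatewise support
  (`(x_δ, y_δ', z_δ'') ∈ S^N ⇒ δ = δ' = δ''`), `t^{⊗N} ≥ ⊕_{δ ∈ Δ} t^{⊗N}(δ)` (`familyDirectSum`;
  BCS Prop. 15.30, Le Gall (8)).
* `laserBlock_comp_perm`, `tensorRestrictsTo_laserBlock_of_letterCount_eq` — blocks whose label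
  words have the same type differ by a permutation of the tensor factors, hence restrict to each
  other ("the value is invariant under permutation of coordinates", Le Gall p. 24).
* `tensorRestrictsTo_kroneckerPow_multiple_laserBlock` — consequently, if all blocks of the free
  diagonal `Δ` have type `Q = letterCount w₀`, then **`t^{⊗N} ≥ ⟨|Δ|⟩ ⊗ laserBlock w₀`**.

One definition (`laserBlock`, an abbreviation); everything else proved; no named facts.  The value
consequences (`V_ρ(t^{⊗N}) ≥ |Δ| ∏_s V_ρ(t(s))^{N Q(s)}`) are drawn in `LaserMethodValues.lean`.

## References

* F. Le Gall, *Powers of tensors and fast matrix multiplication*, ISSAC 2014, arXiv:1401.7714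
  (held: `paper:arxiv-1401.7714`), Thm. 4.1 and Appendix A.3, Eqs. (4)–(8), pp. 21–24. [LeGall2014]
* P. Bürgisser, M. Clausen, M. A. Shokrollahi, *Algebraic Complexity Theory* (1997), Prop. 15.30,
  proof of Thm. 15.41 (p. 381: `t^{⊗N}(x,y,z) ≃ ⊗_ρ t(x_ρ,y_ρ,z_ρ)`). [BurgisserClausenShokrollahi1997]
* D. Coppersmith, S. Winograd, J. Symbolic Comput. 9 (1990), §8. [CoppersmithWinograd1990]
-/

noncomputable section

open scoped BigOperators
open Finset

namespace Literature.Computability.AlgebraicComplexity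

universe u

/-! ## Blocks of the power as Kronecker products of components -/

section Blocks

variable {K : Type u} [CommSemiring K]
variable {ι κ μ : Type*} {I J L : Type*} [DecidableEq I] [DecidableEq J] [DecidableEq L]

/-- **The block `t^{⊗N}(w) = ⊗_ρ t(w_ρ)` of the power** with label word `w` (BCS p. 381; Le Gall
(A.3): "components `t^{⊗N}(a,b,c) = ⊗_ℓ t(a_ℓ,b_ℓ,c_ℓ)`"), the component `t(i,j,l)` being the
zero-out `partSubtensor bI bJ bL t {i} {j} {l}` of `t` to the block `(i,j,l)`.
[cite: LeGall2014, Appendix A.3] -/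
abbrev laserBlock (bI : ι → I) (bJ : κ → J) (bL : μ → L) (t : ι → κ → μ → K) {N : ℕ}
    (w : Fin N → I × J × L) : (Fin N → ι) → (Fin N → κ) → (Fin N → μ) → K :=
  kroneckerPi fun ρ => partSubtensor bI bJ bL t {(w ρ).1} {(w ρ).2.1} {(w ρ).2.2}

/-- The block with label word `w` is the zero-out of `t^{⊗N}` to the index words labelled by `w`.
[cite: LeGall2014, Appendix A.3] -/
theorem laserBlock_apply (bI : ι → I) (bJ : κ → J) (bL : μ → L) (t : ι → κ → μ → K) {N : ℕ}
    (w : Fin N → I × J × L) (a : Fin N → ι) (b : Fin N → κ) (c : Fin N → μ) :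
    laserBlock bI bJ bL t w a b c =
      if ∀ ρ, bI (a ρ) = (w ρ).1 ∧ bJ (b ρ) = (w ρ).2.1 ∧ bL (c ρ) = (w ρ).2.2
      then kroneckerPow t N a b c else 0 := by
  by_cases H : ∀ ρ, bI (a ρ) = (w ρ).1 ∧ bJ (b ρ) = (w ρ).2.1 ∧ bL (c ρ) = (w ρ).2.2
  · rw [if_pos H]
    simp only [laserBlock, kroneckerPi_apply, kroneckerPow_apply]
    refine Finset.prod_congr rfl fun ρ _ => ?_
    rw [partSubtensor_apply, if_pos (by simpa only [Finset.mem_singleton] using H ρ)]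
  · rw [if_neg H]
    simp only [laserBlock, kroneckerPi_apply]
    obtain ⟨ρ, hρ⟩ := not_forall.1 H
    refine Finset.prod_eq_zero (Finset.mem_univ ρ) ?_
    rw [partSubtensor_apply, if_neg (by simpa only [Finset.mem_singleton] using hρ)]

/-- **Blocks of the same type are relabellings of each other**: `t^{⊗N}(w ∘ σ)` is `t^{⊗N}(w)` read
through the coordinate permutation `σ`. [cite: LeGall2014, Appendix A.3 (p. 24)] -/
theorem laserBlock_comp_perm (bI : ι → I) (bJ : κ → J) (bL : μ → L) (t : ι → κ → μ → K) {N : ℕ}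
    (w : Fin N → I × J × L) (σ : Equiv.Perm (Fin N)) :
    laserBlock bI bJ bL t (w ∘ σ) = fun a b c =>
      laserBlock bI bJ bL t w (a ∘ σ.symm) (b ∘ σ.symm) (c ∘ σ.symm) := by
  funext a b c
  simp only [laserBlock, kroneckerPi_apply, Function.comp_apply]
  exact (Equiv.prod_comp σ.symm _).symm.trans (Fintype.prod_congr _ _ fun ρ => by simp)

variable [Fintype ι] [Fintype κ] [Fintype μ] [DecidableEq ι] [DecidableEq κ] [DecidableEq μ]

/-- Hence blocks whose label words have the same type restrict to each other.
[cite: LeGall2014, Appendix A.3 (p. 24)] -/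
theorem tensorRestrictsTo_laserBlock_of_letterCount_eq [Fintype I] [Fintype J] [Fintype L]
    (bI : ι → I) (bJ : κ → J) (bL : μ → L) (t : ι → κ → μ → K) {N : ℕ}
    {w w' : Fin N → I × J × L} (h : letterCount w = letterCount w') :
    TensorRestrictsTo (laserBlock bI bJ bL t w) (laserBlock bI bJ bL t w') := by
  classical
  obtain ⟨σ, hσ⟩ := exists_perm_of_letterCount_eq h.symm
  have hw' : w' = w ∘ σ := funext fun m => (hσ m).symm
  rw [hw', laserBlock_comp_perm]
  exact tensorRestrictsTo_precomp _ _ _ _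

end Blocks

/-! ## A free diagonal of blocks is a restriction of the power -/

section FreeDiagonal

variable {K : Type u} [CommSemiring K]
variable {ι κ μ : Type*} [Fintype ι] [Fintype κ] [Fintype μ] [DecidableEq ι] [DecidableEq κ]
  [DecidableEq μ]
variable {I J L : Type*} [DecidableEq I] [DecidableEq J] [DecidableEq L]

/-- **A free diagonal of blocks is a restriction of `t^{⊗N}`** (BCS Prop. 15.30; Le Gall (8): "`t̂`
can be obtained … by zeroing variables … the sum is direct since the components do not share
variables").  For a finite set `Δ` of triples of label words which is free with respect to the
coordinatewise support (`(x_δ, y_δ', z_δ'') ∈ S^N` only if `δ = δ' = δ''`), `t^{⊗N}` restricts to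
the direct sum over `δ ∈ Δ` of the blocks `t^{⊗N}(δ)`: keep the `x`-words labelled by some `x_δ`
(tagged by `δ`), likewise `y, z`; a surviving entry of `t^{⊗N}` has all its label triples in `S`,
so freeness forces the three tags to agree. [cite: LeGall2014, Appendix A.3, Eq. (8)]
[cite: BurgisserClausenShokrollahi1997, Prop. 15.30] -/
theorem tensorRestrictsTo_kroneckerPow_familyDirectSum_laserBlock (t : ι → κ → μ → K)
    (bI : ι → I) (bJ : κ → J) (bL : μ → L) (S : Finset (I × J × L))
    (hS : ∀ a b c, t a b c ≠ 0 → (bI a, bJ b, bL c) ∈ S) {N : ℕ}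
    (Δ : Finset ((Fin N → I) × (Fin N → J) × (Fin N → L)))
    (hfree : ∀ δ ∈ Δ, ∀ δ' ∈ Δ, ∀ δ'' ∈ Δ, (∀ ρ, (δ.1 ρ, δ'.2.1 ρ, δ''.2.2 ρ) ∈ S) →
      δ = δ' ∧ δ' = δ'') :
    TensorRestrictsTo (kroneckerPow t N)
      (familyDirectSum fun δ : ↥Δ => laserBlock bI bJ bL t (labelSeq δ.1)) := by
  classical
  refine ⟨fun a' a => if a = a'.2 ∧ ∀ ρ, bI (a ρ) = a'.1.1.1 ρ then 1 else 0,
    fun b' b => if b = b'.2 ∧ ∀ ρ, bJ (b ρ) = b'.1.1.2.1 ρ then 1 else 0,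
    fun c' c => if c = c'.2 ∧ ∀ ρ, bL (c ρ) = c'.1.1.2.2 ρ then 1 else 0, fun a' b' c' => ?_⟩
  rw [Finset.sum_eq_single a'.2 (fun a _ ha => by simp [ha]) (by simp),
    Finset.sum_eq_single b'.2 (fun b _ hb => by simp [hb]) (by simp),
    Finset.sum_eq_single c'.2 (fun c _ hc => by simp [hc]) (by simp)]
  simp only [true_and]
  obtain ⟨⟨δ, hδ⟩, a⟩ := a'
  obtain ⟨⟨δ', hδ'⟩, b⟩ := b'
  obtain ⟨⟨δ'', hδ''⟩, c⟩ := c'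
  rw [familyDirectSum_apply]
  dsimp only
  by_cases hdiag : (⟨δ, hδ⟩ : ↥Δ) = ⟨δ', hδ'⟩ ∧ (⟨δ', hδ'⟩ : ↥Δ) = ⟨δ'', hδ''⟩
  · -- a diagonal block
    obtain ⟨h1, h2⟩ := hdiag
    rw [if_pos ⟨h1, h2⟩]
    simp only [Subtype.mk.injEq] at h1 h2
    subst h1 h2
    rw [laserBlock_apply]
    by_cases H : ∀ ρ, bI (a ρ) = (labelSeq δ ρ).1 ∧ bJ (b ρ) = (labelSeq δ ρ).2.1 ∧
        bL (c ρ) = (labelSeq δ ρ).2.2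
    · rw [if_pos H, if_pos fun ρ => (H ρ).1, if_pos fun ρ => (H ρ).2.1, if_pos fun ρ => (H ρ).2.2]
      ring
    · rw [if_neg H]
      by_cases H1 : ∀ ρ, bI (a ρ) = (labelSeq δ ρ).1
      · by_cases H2 : ∀ ρ, bJ (b ρ) = (labelSeq δ ρ).2.1
        · by_cases H3 : ∀ ρ, bL (c ρ) = (labelSeq δ ρ).2.2
          · exact absurd (fun ρ => ⟨H1 ρ, H2 ρ, H3 ρ⟩) H
          · rw [if_neg H3]; ring
        · rw [if_neg H2]; ring
      · rw [if_neg H1]; ring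
  · -- an off-diagonal position: a non-zero entry of `t^{⊗N}` would contradict freeness
    rw [if_neg hdiag]
    by_cases H1 : ∀ ρ, bI (a ρ) = δ.1 ρ
    · by_cases H2 : ∀ ρ, bJ (b ρ) = δ'.2.1 ρ
      · by_cases H3 : ∀ ρ, bL (c ρ) = δ''.2.2 ρ
        · rw [if_pos H1, if_pos H2, if_pos H3]
          by_cases ht : kroneckerPow t N a b c = 0
          · rw [ht]; ring
          · exfalso
            refine hdiag ?_
            have hsupp : ∀ ρ, (δ.1 ρ, δ'.2.1 ρ, δ''.2.2 ρ) ∈ S := by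
              intro ρ
              rw [kroneckerPow_apply] at ht
              have hρ : t (a ρ) (b ρ) (c ρ) ≠ 0 := fun h0 =>
                ht (Finset.prod_eq_zero (Finset.mem_univ ρ) h0)
              rw [← H1 ρ, ← H2 ρ, ← H3 ρ]
              exact hS _ _ _ hρ
            obtain ⟨e1, e2⟩ := hfree δ hδ δ' hδ' δ'' hδ'' hsupp
            subst e1 e2
            exact ⟨rfl, rfl⟩
        · rw [if_neg H3]; ring
      · rw [if_neg H2]; ring
    · rw [if_neg H1]; ring

/-- **All blocks of one type: `t^{⊗N} ≥ ⟨|Δ|⟩ ⊗ t^{⊗N}(w₀)`.**  If moreover every block of the free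
diagonal `Δ` has label word of type `letterCount w₀` (Le Gall's `Δ ⊆ Λ*`, the triples of type
`P`), then `t^{⊗N}` restricts to `|Δ|` independent copies of the single block `t^{⊗N}(w₀)`
(blocks of equal type are relabellings of each other). [cite: LeGall2014, Appendix A.3, Eqs. (5)–(8)] -/
theorem tensorRestrictsTo_kroneckerPow_multiple_laserBlock [Fintype I] [Fintype J] [Fintype L]
    (t : ι → κ → μ → K) (bI : ι → I) (bJ : κ → J) (bL : μ → L) (S : Finset (I × J × L))
    (hS : ∀ a b c, t a b c ≠ 0 → (bI a, bJ b, bL c) ∈ S) {N : ℕ}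
    (Δ : Finset ((Fin N → I) × (Fin N → J) × (Fin N → L)))
    (hfree : ∀ δ ∈ Δ, ∀ δ' ∈ Δ, ∀ δ'' ∈ Δ, (∀ ρ, (δ.1 ρ, δ'.2.1 ρ, δ''.2.2 ρ) ∈ S) →
      δ = δ' ∧ δ' = δ'')
    (w₀ : Fin N → I × J × L) (htype : ∀ δ ∈ Δ, letterCount (labelSeq δ) = letterCount w₀) :
    TensorRestrictsTo (kroneckerPow t N)
      (kroneckerTensor (unitTensor K Δ.card) (laserBlock bI bJ bL t w₀)) := by
  classical
  -- `t^{⊗N} ≥ ⊕_δ t^{⊗N}(δ) ≥ ⊕_δ t^{⊗N}(w₀) ≥ ⊕_{Fin |Δ|} t^{⊗N}(w₀) = ⟨|Δ|⟩ ⊗ t^{⊗N}(w₀)`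
  have h1 := tensorRestrictsTo_kroneckerPow_familyDirectSum_laserBlock t bI bJ bL S hS Δ hfree
  have h2 : TensorRestrictsTo (familyDirectSum fun δ : ↥Δ => laserBlock bI bJ bL t (labelSeq δ.1))
      (familyDirectSum fun _ : ↥Δ => laserBlock bI bJ bL t w₀) :=
    familyDirectSum_mono fun δ =>
      tensorRestrictsTo_laserBlock_of_letterCount_eq bI bJ bL t (htype δ.1 δ.2)
  have h3 : TensorRestrictsTo (familyDirectSum fun _ : ↥Δ => laserBlock bI bJ bL t w₀)
      (familyDirectSum fun _ : Fin Δ.card => laserBlock bI bJ bL t w₀) :=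
    familyDirectSum_reindex (fun _ : ↥Δ => laserBlock bI bJ bL t w₀) Δ.equivFin.symm.injective
  rw [← familyDirectSum_const]
  exact (h1.trans h2).trans h3

end FreeDiagonal

end Literature.Computability.AlgebraicComplexity
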